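import Summits.CriticalPhenomena.PercolationContinuityZ3.Theorems.PercNearOneGluingNoHeavyQuantBlockCombHairRow
import Summits.CriticalPhenomena.PercolationContinuityZ3.Theorems.PercNearOneGluingNoHeavyQuantBlockCombLightRoot
import HarnessLib

/-!
# QUANT lane R8, FAR on trees beyond block-combs: a block-comb plus ONE ROOT HAIR OF ARBITRARY MULTIPLICITIES (carrier of `cc` relays at
# gate `w`, pendant of `cr` relays one private gate `u` further down) — canonical form, floors with `x³ + x ≥ 1`

builds on p205010 (kernel theorem, internal audit signed; external expert review pending)

Support file (`--supports stmt-CriticalPhenomena-4575`), QUANT lane census seat prim-quant-census-1 (gen 14), rung R8 of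
`run/shared/lean/prim/quant/LADDER.md`; memo `run/shared/lean/prim/quant/prim-quant-census-1/TREES-G14.md` §5.

This is LEAD-NOTES-G14 N25 (1)'s "first open shape" (block-comb + one two-relay hair at the root, multiplicities `c_c`, `c_r`), for which
census-1 g13's `tail_ge_of_mean_hair` (p248279) and p1 g10's cherry-comb row cover `c_c = c_r` only.  Canonical form as in `…QuantBlockCombHairRow.lean`:
a spare dead index `υ` at the ROOT (`lv υ = 0`, `a υ = 0`) and `T h = TAIL[D, q, lv, a[υ ↦ h], g[υ ↦ 1], j]` (the block-comb tail with `h` sure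
relays at the root); the hair contributes `(1 − w)·T 0 + w(1 − u)·T cc + w u·T (cc + cr)` (gate-coordinate identity: typer g16's
`BlockCombGate.real_heavy_side_eq_sum`, p248816).

* `BlockComb.tail_sure_shift_root` — layer shift: `TAIL[a[υ ↦ cc + h], g, j] = TAIL[a[υ ↦ h], g, j − cc]` for a root index with `g υ = 1`, `cc ≤ j`.
* `BlockComb.tail_ge_of_mean_hairRoot` — **THE ROW (regime `μ_H ≥ cc`, i.e. `w(cc + u·cr) ≥ cc`)**: block-comb proper (every live marginal `≥ x`,
  floor `x = ∏_{i<D} q i`, `0 < x < 1`, `x³ + x ≥ 1`), hair with `0 < cc`, `0 < cr`, `x ≤ w < 1`, `0 ≤ u ≤ 1`, `x ≤ w u`, carrier gate `w ≥ 2 − 1/x`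
  (stated `2x − 1 ≤ w x`), budget `2j < Σ a·marg + w·cc + w·u·cr` ⟹ `x ≤ (1 − w)·T 0 + w(1 − u)·T cc + w u·T (cc + cr)`.
  PROOF = census-2 g49's exact identity (ARCH-TREES-G49 §1.1 (B+C)): the hair law `(1−w, w−wu, wu)` on `(0, cc, cc+cr)` is
  `π_B·blob(cc+cr, g_B) ⊕ π_C·[cc SURE ⊕ blob(cr, g_C)]`, `g_B = μ_H/(cc+cr) ∈ [x,1)`, `g_C = (μ_H − cc)/cr ∈ [0, wu]`; component B is a proper
  block-comb with the same budget (`tail_ge_of_mean`); component C, after the layer shift by `cc`, is a block-comb plus one ROOT blob `(cr, g_C)` at layer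
  `j − cc`: proper if `g_C ≥ x`, D-ROOT (`tail_ge_of_mean_lightRoot`, census-1 g14) if `x² ≤ g_C < x` — the carrier condition `w ≥ 2 − 1/x` is exactly
  what makes its discounted credit `≥ μ_H` — and two proper block-combs if `g_C < x²`.  A giant hair (`cc + cr ≥ j+1`) is immediate.
* Companion `…QuantBlockCombHairGeneralAB.lean`: `BlockComb.tail_ge_of_mean_hairRoot_AB` — regime `μ_H ≤ cc` (identity (A+B), two proper blobs; every
  floor `0 < x`, no carrier condition).
[cite: KozmaNitzan2024, Conjecture 3 (p. 15)] (the gluing rows served); the rows are [this work] (decomposition identities: census-2 g49).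
Theorems only (the `local notation3` of `…QuantBlockCombMergeModel.lean`, verbatim), no sorries, standard axioms.
-/

namespace Summit.CriticalPhenomena.PercolationContinuityZ3.Theorems

namespace Quant

namespace BlockComb

open Finset

variable {κ : Type*} [Fintype κ] [DecidableEq κ]

/-- product-Bernoulli weight of the set `S` of open blob gates -/
local notation3 "wt[" g ", " S "]" => ∏ k, (if k ∈ (S : Finset κ) then (g : κ → ℝ) k else 1 - (g : κ → ℝ) k)
/-- probability that the chain `q` of length `D` is open exactly to depth `i` -/
local notation3 "pd[" D ", " q ", " i "]" =>
  (∏ i' ∈ Finset.range (i : ℕ), (q : ℕ → ℝ) i') * (if (i : ℕ) < (D : ℕ) then 1 - (q : ℕ → ℝ) i else 1)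
/-- mass counted at depth `i` in blob configuration `S` -/
local notation3 "mass[" lv ", " a ", " i ", " S "]" =>
  ∑ k ∈ (S : Finset κ).filter (fun k => (lv : κ → ℕ) k ≤ (i : ℕ)), ((a : κ → ℕ) k : ℕ)
/-- the tail `P(N ≥ j+1)` of the block-comb count, as an explicit finite sum -/
local notation3 "TAIL[" D ", " q ", " lv ", " a ", " g ", " j "]" =>
  ∑ i ∈ Finset.range ((D : ℕ) + 1), pd[D, q, i] *
    ∑ S : Finset κ, wt[g, S] * (if (j : ℕ) + 1 ≤ mass[lv, a, i, S] then (1 : ℝ) else 0)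

/-! ### 1. Layer shift by a sure root blob -/

/-- **Layer shift.**  For a root index `υ` (`lv υ = 0`) whose gate is `1`, putting `cc + h` relays on `υ` at layer `j` is the same as putting
`h` relays on `υ` at layer `j − cc` (`cc ≤ j`): configurations not containing `υ` have weight `0`, the others count `cc` sure relays. [this work] -/
theorem tail_sure_shift_root (D : ℕ) (q : ℕ → ℝ) (lv : κ → ℕ) (a : κ → ℕ) (g : κ → ℝ) (j : ℕ) (υ : κ) (hυ0 : lv υ = 0)
    (hg1 : g υ = 1) (cc h : ℕ) (hcc : cc ≤ j) :
    TAIL[D, q, lv, Function.update a υ (cc + h), g, j] = TAIL[D, q, lv, Function.update a υ h, g, j - cc] := by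
  refine Finset.sum_congr rfl fun i _ => ?_
  congr 1
  refine Finset.sum_congr rfl fun S _ => ?_
  by_cases hυS : υ ∈ S
  · have hmem : υ ∈ S.filter (fun k => lv k ≤ i) := Finset.mem_filter.2 ⟨hυS, by rw [hυ0]; exact Nat.zero_le _⟩
    have e1 : mass[lv, Function.update a υ (cc + h), i, S] = (cc + h) + ∑ k ∈ (S.filter (fun k => lv k ≤ i)) \ {υ}, a k :=
      Finset.sum_update_of_mem hmem _ _
    have e2 : mass[lv, Function.update a υ h, i, S] = h + ∑ k ∈ (S.filter (fun k => lv k ≤ i)) \ {υ}, a k :=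
      Finset.sum_update_of_mem hmem _ _
    rw [e1, e2]
    congr 1
    by_cases hle : j - cc + 1 ≤ h + ∑ k ∈ (S.filter (fun k => lv k ≤ i)) \ {υ}, a k
    · rw [if_pos hle, if_pos (by omega)]
    · rw [if_neg hle, if_neg (by omega)]
  · have hw : wt[g, S] = 0 := by
      refine Finset.prod_eq_zero (Finset.mem_univ υ) ?_
      rw [if_neg hυS, hg1, sub_self]
    rw [hw, zero_mul, zero_mul]

/-! ### 2. The general root hair, regime `μ_H ≥ cc` -/

/-- **Block-comb + one root hair of arbitrary multiplicities, regime `w(cc + u·cr) ≥ cc`, floors with `x³ + x ≥ 1`, carrier gate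
`w ≥ 2 − 1/x`.**  See the module docstring. [this work] -/
theorem tail_ge_of_mean_hairRoot (D : ℕ) (q : ℕ → ℝ) (hq : ∀ i, 0 ≤ q i ∧ q i ≤ 1) (lv : κ → ℕ) (a : κ → ℕ)
    (g : κ → ℝ) (hg : ∀ k, 0 ≤ g k ∧ g k ≤ 1) (j : ℕ) (hlv : ∀ k, 0 < a k → lv k ≤ D)
    (x : ℝ) (hx0 : 0 < x) (hx1 : x < 1) (hx3 : 1 ≤ x ^ 3 + x) (hxq : x = ∏ i ∈ Finset.range D, q i)
    (υ : κ) (hυ0 : lv υ = 0) (haυ : a υ = 0) (cc cr : ℕ) (hcc : 0 < cc) (hcr : 0 < cr)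
    (w u : ℝ) (hxw : x ≤ w) (hw1 : w < 1) (hu : 0 ≤ u ∧ u ≤ 1) (hwu : x ≤ w * u)
    (hcarrier : 2 * x - 1 ≤ w * x) (hregime : (cc : ℝ) ≤ w * cc + w * u * cr)
    (hmarg : ∀ k, 0 < a k → x ≤ (∏ i ∈ Finset.range (lv k), q i) * g k)
    (hbudget : (2 * j : ℝ) < ∑ k, (a k : ℝ) * ((∏ i ∈ Finset.range (lv k), q i) * g k) + (w * cc + w * u * cr)) :
    x ≤ (1 - w) * TAIL[D, q, lv, a, Function.update g υ 1, j] +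
        w * (1 - u) * TAIL[D, q, lv, Function.update a υ cc, Function.update g υ 1, j] +
        w * u * TAIL[D, q, lv, Function.update a υ (cc + cr), Function.update g υ 1, j] := by
  -- ### generic bookkeeping for the spare root index `υ` (done first, in a small context)
  have hmargυ : (∏ i ∈ Finset.range (lv υ), q i) = 1 := by rw [hυ0]; simp
  have hg_updt01 : ∀ t : ℝ, 0 ≤ t ∧ t ≤ 1 → ∀ k, 0 ≤ Function.update g υ t k ∧ Function.update g υ t k ≤ 1 := by
    intro t ht k; by_cases hk : k = υ
    · rw [hk, Function.update_self]; exact ht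
    · rw [Function.update_of_ne hk]; exact hg k
  have hlv_upd : ∀ (v : ℕ) k, 0 < Function.update a υ v k → lv k ≤ D := by
    intro v k hk; by_cases hk' : k = υ
    · rw [hk', hυ0]; exact Nat.zero_le _
    · rw [Function.update_of_ne hk'] at hk; exact hlv k hk
  have hmarg_updt : ∀ (v : ℕ) (t : ℝ), x ≤ t → ∀ k, 0 < Function.update a υ v k →
      x ≤ (∏ i ∈ Finset.range (lv k), q i) * Function.update g υ t k := by
    intro v t hxt k hk; by_cases hk' : k = υ
    · rw [hk', hmargυ, Function.update_self, one_mul]; exact hxt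
    · rw [Function.update_of_ne hk'] at hk; rw [Function.update_of_ne hk']; exact hmarg k hk
  have hmarg_updt' : ∀ (v : ℕ) (t : ℝ) k, k ≠ υ → 0 < Function.update a υ v k →
      x ≤ (∏ i ∈ Finset.range (lv k), q i) * Function.update g υ t k := by
    intro v t k hk' hk
    rw [Function.update_of_ne hk'] at hk; rw [Function.update_of_ne hk']; exact hmarg k hk
  have hmarg_t : ∀ (t : ℝ) k, 0 < a k → x ≤ (∏ i ∈ Finset.range (lv k), q i) * Function.update g υ t k := by
    intro t k hk; by_cases hk' : k = υ
    · rw [hk', haυ] at hk; exact absurd hk (lt_irrefl 0)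
    · rw [Function.update_of_ne hk']; exact hmarg k hk
  -- sums over the updated sizes / gates (because `a υ = 0`)
  have hsum_upd : ∀ (v : ℕ) (F : κ → ℝ), ∑ k, ((Function.update a υ v k : ℕ) : ℝ) * F k = v * F υ + ∑ k, (a k : ℝ) * F k := by
    intro v F
    have h' : ∀ k, ((Function.update a υ v k : ℕ) : ℝ) * F k = (a k : ℝ) * F k + (if k = υ then (v : ℝ) * F υ else 0) := by
      intro k
      by_cases hk : k = υ
      · rw [hk, Function.update_self, if_pos rfl, haυ]; push_cast; ring
      · rw [Function.update_of_ne hk, if_neg hk, add_zero]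
    rw [Finset.sum_congr rfl fun k _ => h' k, Finset.sum_add_distrib, Finset.sum_ite_eq' Finset.univ υ]
    simp only [Finset.mem_univ, if_true]
    ring
  have hgsum : ∀ t : ℝ, ∑ k, (a k : ℝ) * ((∏ i ∈ Finset.range (lv k), q i) * Function.update g υ t k) =
      ∑ k, (a k : ℝ) * ((∏ i ∈ Finset.range (lv k), q i) * g k) := by
    intro t; refine Finset.sum_congr rfl fun k _ => ?_
    by_cases hk : k = υ
    · rw [hk, haυ]; simp
    · rw [Function.update_of_ne hk]
  have hmean_upd : ∀ (v : ℕ) (t : ℝ), ∑ k, ((Function.update a υ v k : ℕ) : ℝ) * ((∏ i ∈ Finset.range (lv k), q i) * Function.update g υ t k) =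
      (v : ℝ) * t + ∑ k, (a k : ℝ) * ((∏ i ∈ Finset.range (lv k), q i) * g k) := by
    intro v t
    rw [hsum_upd v (fun k => (∏ i ∈ Finset.range (lv k), q i) * Function.update g υ t k), hmargυ, Function.update_self, one_mul, hgsum t]
  -- the component identity: `TAIL[a[υ↦v], g[υ↦t], j'] = t·TAIL[a[υ↦v], g[υ↦1], j'] + (1−t)·TAIL[a, g[υ↦1], j']`
  have ha0 : Function.update a υ 0 = a := Function.update_eq_self_iff.2 haυ.symm
  have hsplit : ∀ (v : ℕ) (t : ℝ) (j' : ℕ), TAIL[D, q, lv, Function.update a υ v, Function.update g υ t, j'] =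
      t * TAIL[D, q, lv, Function.update a υ v, Function.update g υ 1, j'] + (1 - t) * TAIL[D, q, lv, a, Function.update g υ 1, j'] := by
    intro v t j'
    rw [tail_gate_split D q lv (Function.update a υ v) (Function.update g υ t) j' υ, Function.update_self, Function.update_idem,
      Function.update_idem, ha0, tail_update_dead D q lv a g j' υ t haυ, tail_update_dead D q lv a g j' υ 1 haυ]
  -- ### abbreviations
  set g1 : κ → ℝ := Function.update g υ 1 with hg1def
  set T0 := TAIL[D, q, lv, a, g1, j] with hT0
  set Tc := TAIL[D, q, lv, Function.update a υ cc, g1, j] with hTc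
  set Tn := TAIL[D, q, lv, Function.update a υ (cc + cr), g1, j] with hTn
  set EM : ℝ := ∑ k, (a k : ℝ) * ((∏ i ∈ Finset.range (lv k), q i) * g k) with hEM
  have hg1_01 : ∀ k, 0 ≤ g1 k ∧ g1 k ≤ 1 := hg_updt01 1 ⟨zero_le_one, le_rfl⟩
  have hg1υ : g1 υ = 1 := by rw [hg1def, Function.update_self]
  have hw0 : 0 ≤ w := hx0.le.trans hxw
  have hwu1 : w * u ≤ 1 := by nlinarith [hu.1, hu.2]
  have hccR : (0 : ℝ) < cc := by exact_mod_cast hcc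
  have hcrR : (0 : ℝ) < cr := by exact_mod_cast hcr
  have hT0nn : 0 ≤ T0 := tail_nonneg D q hq lv a g1 hg1_01 j
  have hTcnn : 0 ≤ Tc := tail_nonneg D q hq lv _ g1 hg1_01 j
  have hTnnn : 0 ≤ Tn := tail_nonneg D q hq lv _ g1 hg1_01 j
  -- ### the giant hair
  by_cases hgiant : j + 1 ≤ cc + cr
  · have hTn1 : 1 ≤ Tn := by
      have h := tail_ge_marg_of_giant D q hq lv (Function.update a υ (cc + cr)) g1 hg1_01 j υ
        (by rw [Function.update_self]; exact hgiant) (by rw [hυ0]; exact Nat.zero_le _)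
      rw [hmargυ, hg1υ, one_mul] at h
      exact h
    have h1 : 0 ≤ (1 - w) * T0 := mul_nonneg (by linarith only [hw1]) hT0nn
    have h2 : 0 ≤ w * (1 - u) * Tc := mul_nonneg (mul_nonneg hw0 (by linarith only [hu.2])) hTcnn
    have h3 : w * u ≤ w * u * Tn := by
      have := mul_le_mul_of_nonneg_left hTn1 (mul_nonneg hw0 hu.1); linarith only [this]
    linarith only [h1, h2, h3, hwu]
  push Not at hgiant
  have hncc : cc + cr ≤ j := by omega
  -- ### the two-point parameters of census-2's identity (B+C)
  set μ : ℝ := w * cc + w * u * cr with hμ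
  set nR : ℝ := (cc : ℝ) + cr with hnR
  have hnμ : 0 < nR - μ := by
    have e : nR - μ = cc * (1 - w) + cr * (1 - w * u) := by rw [hnR, hμ]; ring
    rw [e]
    have h1 : 0 < (cc : ℝ) * (1 - w) := mul_pos hccR (by linarith only [hw1])
    have h2 : 0 ≤ (cr : ℝ) * (1 - w * u) := mul_nonneg hcrR.le (by linarith only [hwu1])
    linarith only [h1, h2]
  have hnR0 : 0 < nR := by rw [hnR]; linarith only [hccR, hcrR]
  set gB : ℝ := μ / nR with hgB
  set gC : ℝ := (μ - cc) / cr with hgC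
  have hngB : nR * gB = μ := by rw [hgB]; field_simp
  have hcrgC : (cr : ℝ) * gC = μ - cc := by rw [hgC]; field_simp
  have hgB_ge : w * u ≤ gB := by
    rw [hgB, le_div_iff₀ hnR0, hμ, hnR]
    have h1 : 0 ≤ w * cc * (1 - u) := mul_nonneg (mul_nonneg hw0 hccR.le) (by linarith only [hu.2])
    linarith only [h1]
  have hgB_le : gB ≤ w := by
    rw [hgB, div_le_iff₀ hnR0, hμ, hnR]
    have h1 : 0 ≤ w * cr * (1 - u) := mul_nonneg (mul_nonneg hw0 hcrR.le) (by linarith only [hu.2])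
    linarith only [h1]
  have hgB01 : 0 ≤ gB ∧ gB ≤ 1 := ⟨le_trans (mul_nonneg hw0 hu.1) hgB_ge, hgB_le.trans hw1.le⟩
  have hgBx : x ≤ gB := hwu.trans hgB_ge
  have hgB1 : 0 < 1 - gB := by linarith only [hgB_le, hw1]
  have hgC0 : 0 ≤ gC := by
    rw [hgC]; exact div_nonneg (by rw [hμ]; linarith only [hregime]) hcrR.le
  have hgC_le : gC ≤ w * u := by
    rw [hgC, div_le_iff₀ hcrR, hμ]
    have h1 : 0 ≤ (cc : ℝ) * (1 - w) := mul_nonneg hccR.le (by linarith only [hw1])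
    linarith only [h1]
  have hgC01 : 0 ≤ gC ∧ gC ≤ 1 := ⟨hgC0, hgC_le.trans hwu1⟩
  set πB : ℝ := (1 - w) / (1 - gB) with hπB
  set πC : ℝ := (w - gB) / (1 - gB) with hπC
  have hπB0 : 0 ≤ πB := div_nonneg (by linarith only [hw1]) hgB1.le
  have hπC0 : 0 ≤ πC := div_nonneg (by linarith only [hgB_le]) hgB1.le
  -- coefficient identities
  have hnRne : nR ≠ 0 := ne_of_gt hnR0
  have hcrne : (cr : ℝ) ≠ 0 := ne_of_gt hcrR
  have h1gBne : 1 - gB ≠ 0 := ne_of_gt hgB1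
  have c0 : πB * (1 - gB) = 1 - w := by rw [hπB]; field_simp
  have c1 : πC * (1 - gC) = w * (1 - u) := by
    rw [hπC, hgC, hgB]
    field_simp
    rw [hμ, hnR]; ring
  have c2 : πB * gB + πC * gC = w * u := by
    rw [hπB, hπC, hgC, hgB]
    field_simp
    rw [hμ, hnR]; ring
  -- ### component B: one proper root blob of size `cc + cr` and gate `gB`, at layer `j`
  have hB : x ≤ gB * Tn + (1 - gB) * T0 := by
    have hbudgetB : (2 * j : ℝ) < ∑ k, ((Function.update a υ (cc + cr) k : ℕ) : ℝ) *
        ((∏ i ∈ Finset.range (lv k), q i) * Function.update g υ gB k) := by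
      rw [hmean_upd (cc + cr) gB]
      have e : (((cc + cr : ℕ) : ℕ) : ℝ) * gB = μ := by rw [← hngB, hnR]; push_cast; ring
      rw [e]; linarith only [hbudget]
    have hfar := tail_ge_of_mean D q hq lv (Function.update a υ (cc + cr)) (Function.update g υ gB) (hg_updt01 gB hgB01) j
      (hlv_upd (cc + cr)) x hx0 hxq (hmarg_updt (cc + cr) gB hgBx) hbudgetB
    rw [hsplit (cc + cr) gB j] at hfar
    exact hfar
  -- ### component C: `cc` sure relays plus one root blob `(cr, gC)`, at layer `j − cc`
  have hC : x ≤ (1 - gC) * Tc + gC * Tn := by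
    -- layer shift
    have hTc' : Tc = TAIL[D, q, lv, a, g1, j - cc] := by
      have h := tail_sure_shift_root D q lv a g1 j υ hυ0 hg1υ cc 0 (by omega)
      rw [add_zero, ha0] at h
      rw [hTc]; exact h
    have hTn' : Tn = TAIL[D, q, lv, Function.update a υ cr, g1, j - cc] := by
      rw [hTn]; exact tail_sure_shift_root D q lv a g1 j υ hυ0 hg1υ cc cr (by omega)
    rw [hTc', hTn']
    have hjcc : ((j - cc : ℕ) : ℝ) = (j : ℝ) - cc := by rw [Nat.cast_sub (by omega)]
    -- the discounted-credit inequality from the carrier condition: `EM + 2cc + cr·κ(gC) > 2j`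
    have hcredit : (2 * j : ℝ) < EM + 2 * cc + cr * ((gC - x ^ 2) / (1 - x)) := by
      have h1x : 0 < 1 - x := by linarith only [hx1]
      have hp1 : 0 ≤ (cc : ℝ) * (w * x - (2 * x - 1)) := mul_nonneg hccR.le (by linarith only [hcarrier])
      have hp2 : 0 ≤ (cr : ℝ) * (x * (w * u - x)) := mul_nonneg hcrR.le (mul_nonneg hx0.le (by linarith only [hwu]))
      have hkey : μ * (1 - x) ≤ 2 * cc * (1 - x) + ((cr : ℝ) * gC - cr * x ^ 2) := by
        rw [hcrgC, hμ]; linarith only [hp1, hp2]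
      have hK : μ - 2 * cc ≤ (cr : ℝ) * (gC - x ^ 2) / (1 - x) := by
        rw [le_div_iff₀ h1x]; linarith only [hkey]
      have hK' : (cr : ℝ) * ((gC - x ^ 2) / (1 - x)) = (cr : ℝ) * (gC - x ^ 2) / (1 - x) := (mul_div_assoc _ _ _).symm
      rw [hK']
      linarith only [hK, hbudget]
    by_cases hgCx : x ≤ gC
    · -- proper blob
      have hbudgetC : (2 * (j - cc : ℕ) : ℝ) < ∑ k, ((Function.update a υ cr k : ℕ) : ℝ) *
          ((∏ i ∈ Finset.range (lv k), q i) * Function.update g υ gC k) := by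
        rw [hmean_upd cr gC, hcrgC, hjcc]
        linarith only [hbudget, hccR]
      have hfar := tail_ge_of_mean D q hq lv (Function.update a υ cr) (Function.update g υ gC) (hg_updt01 gC hgC01) (j - cc)
        (hlv_upd cr) x hx0 hxq (hmarg_updt cr gC hgCx) hbudgetC
      rw [hsplit cr gC (j - cc)] at hfar
      linarith only [hfar]
    push Not at hgCx
    by_cases hgCx2 : x ^ 2 ≤ gC
    · -- D-root: one light root blob at layer `j − cc`
      have herase : ∑ k ∈ (Finset.univ : Finset κ).erase υ, ((Function.update a υ cr k : ℕ) : ℝ) *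
          ((∏ i ∈ Finset.range (lv k), q i) * Function.update g υ gC k) = EM := by
        rw [hEM, ← Finset.add_sum_erase _ (fun k => (a k : ℝ) * ((∏ i ∈ Finset.range (lv k), q i) * g k)) (Finset.mem_univ υ), haυ]
        push_cast
        rw [zero_mul, zero_add]
        refine Finset.sum_congr rfl fun k hk => ?_
        have hk' : k ≠ υ := Finset.ne_of_mem_erase hk
        rw [Function.update_of_ne hk', Function.update_of_ne hk']
      have hcreditC : (2 * (j - cc : ℕ) : ℝ) < (∑ k ∈ (Finset.univ : Finset κ).erase υ, ((Function.update a υ cr k : ℕ) : ℝ) *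
          ((∏ i ∈ Finset.range (lv k), q i) * Function.update g υ gC k)) +
          (Function.update a υ cr υ : ℕ) * ((Function.update g υ gC υ - x ^ 2) / (1 - x)) := by
        rw [herase, Function.update_self, Function.update_self, hjcc]
        linarith only [hcredit]
      have hfar := tail_ge_of_mean_lightRoot D q hq lv (Function.update a υ cr) (Function.update g υ gC) (hg_updt01 gC hgC01) (j - cc)
        (hlv_upd cr) x hx0 hx1 hx3 hxq υ hυ0
        (by rw [Function.update_self]; exact hgCx2) (by rw [Function.update_self]; exact hgCx.le)
        (by rw [Function.update_self]; omega) (hmarg_updt' cr gC) hcreditC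
      rw [hsplit cr gC (j - cc)] at hfar
      linarith only [hfar]
    · -- `gC < x²`: negative credit, so `EM > 2(j − cc)`; both `T' 0` and `T' cr` are proper block-comb tails
      push Not at hgCx2
      have hEMcc : (2 * (j - cc : ℕ) : ℝ) < EM := by
        rw [hjcc]
        have hneg : (cr : ℝ) * ((gC - x ^ 2) / (1 - x)) ≤ 0 :=
          mul_nonpos_of_nonneg_of_nonpos hcrR.le (div_nonpos_of_nonpos_of_nonneg (by linarith only [hgCx2]) (by linarith only [hx1]))
        linarith only [hneg, hcredit]
      have hfar0 := tail_ge_of_mean D q hq lv a g1 hg1_01 (j - cc) hlv x hx0 hxq (hmarg_t 1) (by rw [hgsum 1]; exact hEMcc)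
      have hfarC := tail_ge_of_mean D q hq lv (Function.update a υ cr) g1 hg1_01 (j - cc) (hlv_upd cr) x hx0 hxq
        (hmarg_updt cr 1 hx1.le) (by rw [hmean_upd cr 1]; linarith only [hEMcc, hcrR])
      have hP1 : 0 ≤ (1 - gC) * (TAIL[D, q, lv, a, g1, j - cc] - x) := mul_nonneg (sub_nonneg.2 hgC01.2) (sub_nonneg.2 hfar0)
      have hP2 : 0 ≤ gC * (TAIL[D, q, lv, Function.update a υ cr, g1, j - cc] - x) := mul_nonneg hgC01.1 (sub_nonneg.2 hfarC)
      linarith only [hP1, hP2]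
  -- ### assemble: Φ = πB·(B) + πC·(C)
  have e : πB * (gB * Tn + (1 - gB) * T0) + πC * ((1 - gC) * Tc + gC * Tn) = (1 - w) * T0 + w * (1 - u) * Tc + w * u * Tn := by
    linear_combination T0 * c0 + Tc * c1 + Tn * c2
  have hsum1 : πB + πC = 1 := by rw [hπB, hπC]; field_simp; ring
  calc x = πB * x + πC * x := by rw [← add_mul, hsum1, one_mul]
    _ ≤ πB * (gB * Tn + (1 - gB) * T0) + πC * ((1 - gC) * Tc + gC * Tn) :=
        add_le_add (mul_le_mul_of_nonneg_left hB hπB0) (mul_le_mul_of_nonneg_left hC hπC0)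
    _ = (1 - w) * T0 + w * (1 - u) * Tc + w * u * Tn := e

end BlockComb

end Quant

end Summit.CriticalPhenomena.PercolationContinuityZ3.Theorems
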